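import Summits.RiemannHypothesis.RiemannHypothesis.Theorems.PfPersistenceHeavySlotMirrorNodal
import HarnessLib

/-!
# PF persistence — HEAVY DIALS ARE DETECTABLY NEGATIVE AT THEIR MIRROR WINDOW: the rejection theorem of
`PfPersistenceHeavySlotMirrorNodal` is SOUNDNESS BY PROOF on that family (pub-rhpf, cand-6 gen 7)

**HONEST FRAMING. This is a long-odds MECHANISM SEARCH ('mechanism/rigidity campaign'); no RH claims.** Every statement
below is RH-free bookkeeping about the cell's observatory records (truncated Weil matrices of weight tables); nothing here
bears on the truth of RH. Labels: PROVED = kernel-checked here or in the imported tree files.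

THE POINT (RULING A187 (A1), row C6-MIRROR-NODAL). The tree proves (d7caf17db7a9) that every HEAVY dial —
`|K − 1| w(p) ≥ 3B`, `B² ≥ Σ (Q^±_{ij})²` at the mirror window `(log p, N)` — is REJECTED by the floored nodeless readers there
(`heavyDial_not_mem_floorNodelessEOAt`), but it states no negativity of that witness. This file supplies the one-line
corollary: under the SAME even-block bound the heavy dial is NOT window-positive AT THAT SAME WINDOW (a diagonal entry of its
even block is `≤ B − |K − 1| w(p) < 0`: entry `(1,1)` for a down dial, `(0,0)` for an up dial), hence `DetectablyNegative`.
So on the heavy-dial family the reader's verdict 'reject' falls exactly on detectably negative RH-free data: SOUND BY PROOF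
on that family (the (S)-column sentence of the row), for every weight table, every slot `p ≥ 2`, every `N ≥ 1` (`N ≥ 2` for
the two-parity handle), every admissible floor; `ζ` versions with `|K − 1| ≥ 3B / w(p) + 1`, `p` prime.

* `heavyDial_detectablyNegative` — `DetectablyNegative ∧ ¬ WindowPositive` at the mirror window (either sign, `N ≥ 1`).
* `heavyDial_negative_and_rejected` — with both block bounds and `N ≥ 2`: `… ∧ datumOf (dial p K w) ∉ floorNodelessEOAt φ win`.
* sign-split versions for the single-sector leaves: `heavyDownDial_negative_and_rejected` (G1.01, `floorNodelessAt`),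
  `heavyUpDial_negative_and_rejected` (G1.02, `floorNodelessOddAt`; the odd bound rejects, the even bound gives negativity).
* `zeta_heavyDial_negative_and_rejected`, `zeta_floorNodelessEO_rejects_every_heavy_negative`.

Not a closure and not a separation claim: LIGHT dials (`|K − 1| w(p) < 3B`) are not decided here (see the parity-splitting law
of `PfPersistenceParitySplitLaw` for the sharp threshold); nothing about `ζ` enters.
-/

set_option linter.dupNamespace false  -- the mandated namespace repeats `RiemannHypothesis`

noncomputable section

open Real Set Matrix Finset

namespace Summit.RiemannHypothesis.RiemannHypothesis.Theorems.PfPersistence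

/-- PROVED: the diagonal of a dial's even block at its mirror window, `Q⁺(dial)_{ii} = Q⁺(w)_{ii} + (1 − K) w(p) (−1)^i`. [folklore] -/
theorem datumOf_dial_mirror_apply_self {p : ℕ} (hp : 2 ≤ p) {win : Window} (hwin : win.a = Real.log p) (K : ℝ)
    (w : Weights) (i : Fin (win.N + 1)) :
    datumOf (dial p K w) win i i = evenBlock w win i i + (1 - K) * w p * (-1 : ℝ) ^ (i : ℕ) := by
  have hblock : datumOf (dial p K w) win = evenBlock w win + ((1 - K) * w p) • signDiag (win.N + 1) :=
    evenBlock_dial_mirror' hp hwin K w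
  rw [hblock, add_smul_signDiag_apply_self]

/-- PROVED: a negative diagonal entry makes a window matrix NOT window-positive (basis-vector witness). [folklore] -/
theorem not_windowPositive_of_apply_self_neg {n : ℕ} {M : Matrix (Fin n) (Fin n) ℝ} {i : Fin n} (h : M i i < 0) :
    ¬WindowPositive M := by
  intro hW
  have h1 := hW (Pi.single i 1)
  rw [single_form_single] at h1
  linarith

/-- PROVED: a negative diagonal entry at some window makes a datum detectably negative. [folklore] -/
theorem detectablyNegative_of_apply_self_neg {d : Datum} {win : Window} {i : Fin (win.N + 1)} (h : d win i i < 0) :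
    DetectablyNegative d :=
  ⟨win, Pi.single i 1, by rw [single_form_single]; linarith⟩

/-- PROVED (down sign): with `Σ Q⁺_{ij}² ≤ B²`, `B ≥ 0`, `N ≥ 1` and `(1 − K) w(p) > B`, the entry `(1,1)` of the dial's even
block at the mirror window is negative. [folklore] -/
theorem heavyDownDial_apply_one_one_neg {p : ℕ} (hp : 2 ≤ p) {win : Window} (hwin : win.a = Real.log p)
    (hN : 1 ≤ win.N) (w : Weights) {K B : ℝ} (hB0 : 0 ≤ B) (hB : ∑ i, ∑ j, evenBlock w win i j ^ 2 ≤ B ^ 2)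
    (ht : B < (1 - K) * w p) :
    datumOf (dial p K w) win ⟨1, by omega⟩ ⟨1, by omega⟩ < 0 := by
  rw [datumOf_dial_mirror_apply_self hp hwin K w]
  have hQB : evenBlock w win ⟨1, by omega⟩ ⟨1, by omega⟩ ≤ B := apply_le_of_sum_sq_le hB0 hB _ _
  simp only [pow_one]
  linarith

/-- PROVED (up sign): with `Σ Q⁺_{ij}² ≤ B²`, `B ≥ 0` and `(K − 1) w(p) > B`, the entry `(0,0)` is negative. [folklore] -/
theorem heavyUpDial_apply_zero_zero_neg {p : ℕ} (hp : 2 ≤ p) {win : Window} (hwin : win.a = Real.log p)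
    (w : Weights) {K B : ℝ} (hB0 : 0 ≤ B) (hB : ∑ i, ∑ j, evenBlock w win i j ^ 2 ≤ B ^ 2)
    (hc : B < (K - 1) * w p) :
    datumOf (dial p K w) win 0 0 < 0 := by
  rw [datumOf_dial_mirror_apply_self hp hwin K w]
  have hQB : evenBlock w win 0 0 ≤ B := apply_le_of_sum_sq_le hB0 hB _ _
  simp only [Fin.val_zero, pow_zero, mul_one]
  linarith

/-- PROVED: `3B ≤ |t|`, `t ≠ 0`, `B ≥ 0 ⇒ B < |t|`. [folklore] -/
theorem lt_abs_of_three_mul_le {B t : ℝ} (hB0 : 0 ≤ B) (h3 : 3 * B ≤ |t|) (ht : t ≠ 0) : B < |t| := by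
  rcases eq_or_lt_of_le hB0 with h | h
  · rw [← h]; exact abs_pos.2 ht
  · linarith

/-- **PROVED — A HEAVY DIAL OF EITHER SIGN IS DETECTABLY NEGATIVE AT ITS MIRROR WINDOW** (the corollary asked for by RULING
A187 (A1)): every weight table `w`, slot `p ≥ 2`, window `win` with `win.a = log p` and `N ≥ 1`, bound `Σ Q⁺_{ij}² ≤ B²`
(`B ≥ 0`) on `w`'s even block there; if `|K − 1| w(p) ≥ 3B` and `≠ 0` then the dial's datum is NOT window-positive at `win`
and is `DetectablyNegative`. [folklore] -/
theorem heavyDial_detectablyNegative {p : ℕ} (hp : 2 ≤ p) {win : Window} (hwin : win.a = Real.log p)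
    (hN : 1 ≤ win.N) (w : Weights) {K B : ℝ} (hB0 : 0 ≤ B) (hBe : ∑ i, ∑ j, evenBlock w win i j ^ 2 ≤ B ^ 2)
    (hK : 3 * B ≤ |(K - 1) * w p|) (hK0 : (K - 1) * w p ≠ 0) :
    DetectablyNegative (datumOf (dial p K w)) ∧ ¬WindowPositive (datumOf (dial p K w) win) := by
  have hBt : B < |(K - 1) * w p| := lt_abs_of_three_mul_le hB0 hK hK0
  rcases lt_or_gt_of_ne hK0 with hneg | hpos
  · have ht : B < (1 - K) * w p := by
      rw [abs_of_neg hneg] at hBt; linarith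
    have h := heavyDownDial_apply_one_one_neg hp hwin hN w hB0 hBe ht
    exact ⟨detectablyNegative_of_apply_self_neg h, not_windowPositive_of_apply_self_neg h⟩
  · have hc : B < (K - 1) * w p := by rw [abs_of_pos hpos] at hBt; exact hBt
    have h := heavyUpDial_apply_zero_zero_neg hp hwin w hB0 hBe hc
    exact ⟨detectablyNegative_of_apply_self_neg h, not_windowPositive_of_apply_self_neg h⟩

/-- **PROVED — REJECTED AND DETECTABLY NEGATIVE, AT THE SAME WINDOW** (the hypotheses of the tree's
`heavyDial_not_mem_floorNodelessEOAt`): the two-parity floored nodeless reader's rejection of a heavy dial at its mirror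
window falls on a datum that is detectably negative there — soundness BY PROOF on the heavy-dial family. [folklore] -/
theorem heavyDial_negative_and_rejected {p : ℕ} (hp : 2 ≤ p) {win : Window} (hwin : win.a = Real.log p)
    (hN : 2 ≤ win.N) (w : Weights) {K B φ : ℝ} (hB0 : 0 ≤ B)
    (hBe : ∑ i, ∑ j, evenBlock w win i j ^ 2 ≤ B ^ 2) (hBo : ∑ i, ∑ j, oddBlock w win i j ^ 2 ≤ B ^ 2)
    (hK : 3 * B ≤ |(K - 1) * w p|) (hK0 : (K - 1) * w p ≠ 0)
    (hφ : 0 ≤ φ) (hφN : 4 * φ ^ 2 * (2 * win.N + 1) ≤ 1) :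
    DetectablyNegative (datumOf (dial p K w)) ∧ ¬WindowPositive (datumOf (dial p K w) win) ∧
      datumOf (dial p K w) ∉ floorNodelessEOAt φ win := by
  obtain ⟨hD, hW⟩ := heavyDial_detectablyNegative hp hwin (by omega) w hB0 hBe hK hK0
  exact ⟨hD, hW, heavyDial_not_mem_floorNodelessEOAt hp hwin hN w hB0 hBe hBo hK hK0 hφ hφN⟩

/-- PROVED (G1.01, down sign only, `N ≥ 1`, even-block bound): a heavy DOWN dial is detectably negative and NOT in
`floorNodelessAt φ` at its mirror window. [folklore] -/
theorem heavyDownDial_negative_and_rejected {p : ℕ} (hp : 2 ≤ p) {win : Window} (hwin : win.a = Real.log p)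
    (hN : 1 ≤ win.N) (w : Weights) {K B φ : ℝ} (hB0 : 0 ≤ B) (hBe : ∑ i, ∑ j, evenBlock w win i j ^ 2 ≤ B ^ 2)
    (ht0 : 0 < (1 - K) * w p) (ht : 3 * B ≤ (1 - K) * w p) (hφ : 0 ≤ φ) (hφN : 4 * φ ^ 2 * (2 * win.N + 1) ≤ 1) :
    DetectablyNegative (datumOf (dial p K w)) ∧ ¬WindowPositive (datumOf (dial p K w) win) ∧
      datumOf (dial p K w) ∉ floorNodelessAt φ win := by
  have hBt : B < (1 - K) * w p := by
    rcases eq_or_lt_of_le hB0 with h | h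
    · rw [← h]; exact ht0
    · linarith
  have h := heavyDownDial_apply_one_one_neg hp hwin hN w hB0 hBe hBt
  exact ⟨detectablyNegative_of_apply_self_neg h, not_windowPositive_of_apply_self_neg h,
    heavyDownDial_not_mem_floorNodelessAt hp hwin hN w hB0 hBe ht0 ht hφ hφN⟩

/-- PROVED (G1.02, up sign only, `N ≥ 2`; the odd-block bound rejects, the even-block bound gives negativity): a heavy UP dial
is detectably negative and NOT in `floorNodelessOddAt φ` at its mirror window. [folklore] -/
theorem heavyUpDial_negative_and_rejected {p : ℕ} (hp : 2 ≤ p) {win : Window} (hwin : win.a = Real.log p)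
    (hN : 2 ≤ win.N) (w : Weights) {K B φ : ℝ} (hB0 : 0 ≤ B)
    (hBe : ∑ i, ∑ j, evenBlock w win i j ^ 2 ≤ B ^ 2) (hBo : ∑ i, ∑ j, oddBlock w win i j ^ 2 ≤ B ^ 2)
    (hc0 : 0 < (K - 1) * w p) (hc : 3 * B ≤ (K - 1) * w p) (hφ : 0 ≤ φ) (hφN : 8 * φ ^ 2 * win.N ≤ 1) :
    DetectablyNegative (datumOf (dial p K w)) ∧ ¬WindowPositive (datumOf (dial p K w) win) ∧
      datumOf (dial p K w) ∉ floorNodelessOddAt φ win := by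
  have hBt : B < (K - 1) * w p := by
    rcases eq_or_lt_of_le hB0 with h | h
    · rw [← h]; exact hc0
    · linarith
  have h := heavyUpDial_apply_zero_zero_neg hp hwin w hB0 hBe hBt
  exact ⟨detectablyNegative_of_apply_self_neg h, not_windowPositive_of_apply_self_neg h,
    heavyUpDial_not_mem_floorNodelessOddAt hp hwin hN w hB0 hBo hc0 hc hφ hφN⟩

/-- **PROVED — FOR `ζ` (`p` prime): every heavy prime dial `|K − 1| ≥ 3B / w(p) + 1` is detectably negative at its own mirror
window `(log p, N)` AND rejected there by the two-parity floored nodeless reader** (every `N ≥ 2`, every admissible floor). [folklore] -/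
theorem zeta_heavyDial_negative_and_rejected {p : ℕ} (hp : p.Prime) {win : Window} (hwin : win.a = Real.log p)
    (hN : 2 ≤ win.N) {B φ : ℝ} (hB0 : 0 ≤ B)
    (hBe : ∑ i, ∑ j, evenBlock zetaWeights win i j ^ 2 ≤ B ^ 2)
    (hBo : ∑ i, ∑ j, oddBlock zetaWeights win i j ^ 2 ≤ B ^ 2)
    (hφ : 0 ≤ φ) (hφN : 4 * φ ^ 2 * (2 * win.N + 1) ≤ 1) {K : ℝ} (hK : 3 * B / zetaWeights p + 1 ≤ |K - 1|) :
    DetectablyNegative (datumOf (dial p K zetaWeights)) ∧ ¬WindowPositive (datumOf (dial p K zetaWeights) win) ∧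
      datumOf (dial p K zetaWeights) ∉ floorNodelessEOAt φ win := by
  have hw : 0 < zetaWeights p := zetaWeights_pos_of_prime hp
  have hdiv : 0 ≤ 3 * B / zetaWeights p := div_nonneg (by linarith) hw.le
  have hK1 : 3 * B / zetaWeights p ≤ |K - 1| := by linarith
  have hK' : 3 * B ≤ |(K - 1) * zetaWeights p| := by
    rw [abs_mul, abs_of_pos hw]
    have := (div_le_iff₀ hw).1 hK1
    linarith
  have hK0 : (K - 1) * zetaWeights p ≠ 0 := by
    refine mul_ne_zero (fun h => ?_) hw.ne'
    rw [h, abs_zero] at hK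
    linarith
  exact heavyDial_negative_and_rejected hp.two_le hwin hN zetaWeights hB0 hBe hBo hK' hK0 hφ hφN

/-- **PROVED — THE (S)-COLUMN SENTENCE OF ROW C6-MIRROR-NODAL, `ζ` side:** at a mirror window `(log p, N)` of `ζ` with block
bound `B`, EVERY member of the heavy-dial family (`|K − 1| ≥ 3B / w(p) + 1`) is a detectably negative RH-free datum that the
two-parity floored nodeless reader rejects at that window — so no member of this witness family can inhabit the `∀`-window
reader, and the reader's rejection of it is sound by proof. [folklore] -/
theorem zeta_floorNodelessEO_rejects_every_heavy_negative {p : ℕ} (hp : p.Prime) {win : Window}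
    (hwin : win.a = Real.log p) (hN : 2 ≤ win.N) {B φ : ℝ} (hB0 : 0 ≤ B)
    (hBe : ∑ i, ∑ j, evenBlock zetaWeights win i j ^ 2 ≤ B ^ 2)
    (hBo : ∑ i, ∑ j, oddBlock zetaWeights win i j ^ 2 ≤ B ^ 2)
    (hφ : 0 ≤ φ) (hφN : 4 * φ ^ 2 * (2 * win.N + 1) ≤ 1) :
    ∀ K : ℝ, 3 * B / zetaWeights p + 1 ≤ |K - 1| →
      DetectablyNegative (datumOf (dial p K zetaWeights)) ∧
        datumOf (dial p K zetaWeights) ∉ {d : Datum | ∀ win' : Window, d ∈ floorNodelessEOAt φ win'} := by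
  intro K hK
  obtain ⟨hD, -, hR⟩ := zeta_heavyDial_negative_and_rejected hp hwin hN hB0 hBe hBo hφ hφN hK
  exact ⟨hD, fun h => hR (h win)⟩

end Summit.RiemannHypothesis.RiemannHypothesis.Theorems.PfPersistence
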